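import Summits.CriticalPhenomena.CardyFormulaZ2.Theorems.RectilinearCardy.Negative.RectilinearCardySquareInstance

/-!
# `RectilinearCardy → stub_rectCardyOne`, part 0: the corner-marked box `(0,A)×(0,1)` exists

Support file for line `two-cluster-rate-is-stationary-gap` (crux `StripClusterRates`,
stmt-CriticalPhenomena-13878). To feed the route's crux `RectilinearCardy` (Cardy's formula for every
rectilinear conformal rectangle) into the `γ₁` half of the strip-rate statement one needs ONE concrete
conformal rectangle with

* carrier the open box `(0,A)×(0,1)` (integer aspect `A ≥ 1`),
* arc `0` = the left side `{0} × [0,1]` and arc `2` = the right side `{A} × [0,1]` (so that the tree's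
  `bondDomainCrossingProb R δ` is the left-right crossing probability of the lattice box),
* corner marks `i, 0, A, A + i` (the shape consumed by `rectangle_crossRatio_eq_lamR`),
* a rectilinear frontier (the hypothesis of `RectilinearCardy`, i.e. `IsRectilinear R` unfolded).

The witness is the tree's Bollobás–Riordan rectangle `brRect A 1 = (rectQuad 0 1 0 A).map (brHomeo 1)`
(`RectilinearCardySquareInstance.lean`): carrier, marks and rectilinearity are the tree lemmas
`brRect_carrier`, `brRect_pt`, `isRectilinear_brRect`; the new content is the identification of the two
crossing arcs (`RectBoxExists.brRect_arc_zero`, `RectBoxExists.brRect_arc_two`): the quarter turn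
`brHomeo h : u + iv ↦ v + i(h − u)` sends the bottom side of `rectQuad 0 h 0 w` (its arc `0`,
`mem_rectQuad_arc_zero`) onto the left side `{0} × [0,h]` and the top side (arc `2`,
`mem_rectQuad_arc_two`) onto the right side `{w} × [0,h]`. No definitions are introduced.

References: B. Bollobás, O. Riordan, *Percolation* (2006), Ch. 7 §7.1 [BollobasRiordan2006];
S. Smirnov, C. R. Acad. Sci. Paris 333 (2001) 239, §2 [Smirnov2001].
-/

noncomputable section

namespace Summit.CriticalPhenomena.CardyFormulaZ2.Cruxes.StripClusterRates.TwoClusterRateIsStationaryGap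

open Set Complex
open Literature.Probability.RandomPlanarGeometry
open Literature.Probability.Percolation (rectQuad mem_rectQuad_arc_zero mem_rectQuad_arc_two)
open Summit.CriticalPhenomena.CardyFormulaZ2.Theorems.RectilinearCardy.Negative
  (brRect brRect_carrier brRect_pt isRectilinear_brRect IsRectilinear brHomeo brHomeo_apply)

namespace RectBoxExists

/-- Real and imaginary parts of the quarter turn `brHomeo h : u ↦ -i u + i h`:
`re = u.im`, `im = h - u.re`. [folklore] -/
theorem brHomeo_re_im (h : ℝ) (u : ℂ) :
    (brHomeo h u).re = u.im ∧ (brHomeo h u).im = h - u.re := by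
  rw [brHomeo_apply]
  constructor
  · simp
  · simp [neg_add_eq_sub]

/-- The point `(h - z.im) + i z.re` is sent to `z` by `brHomeo h` (the inverse quarter turn). [folklore] -/
theorem brHomeo_mk (h : ℝ) (z : ℂ) : brHomeo h ⟨h - z.im, z.re⟩ = z := by
  rw [brHomeo_apply]
  apply Complex.ext <;> simp

/-- **Arc `0` of the Bollobás–Riordan rectangle `brRect w h` is its left side** `{0} × [0, h]`
(the image of the bottom side of `rectQuad 0 h 0 w` under the quarter turn `brHomeo h`). [folklore] -/
theorem brRect_arc_zero (w h : ℝ) (hw : 0 < w) (hh : 0 < h) :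
    (brRect w h hw hh).arc 0 = {z : ℂ | z.re = 0 ∧ z.im ∈ Icc (0 : ℝ) h} := by
  ext z
  simp only [brRect, MarkedDomain.arc_map, mem_image, mem_setOf_eq]
  constructor
  · rintro ⟨u, hu, rfl⟩
    rw [mem_rectQuad_arc_zero] at hu
    obtain ⟨hi, hr1, hr2⟩ := hu
    obtain ⟨e1, e2⟩ := brHomeo_re_im h u
    rw [e1, e2, hi]
    exact ⟨rfl, by linarith, by linarith⟩
  · rintro ⟨hre, h1, h2⟩
    refine ⟨⟨h - z.im, z.re⟩, ?_, brHomeo_mk h z⟩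
    rw [mem_rectQuad_arc_zero]
    exact ⟨hre, by change 0 ≤ h - z.im; linarith, by change h - z.im ≤ h; linarith⟩

/-- **Arc `2` of the Bollobás–Riordan rectangle `brRect w h` is its right side** `{w} × [0, h]`
(the image of the top side of `rectQuad 0 h 0 w` under the quarter turn `brHomeo h`). [folklore] -/
theorem brRect_arc_two (w h : ℝ) (hw : 0 < w) (hh : 0 < h) :
    (brRect w h hw hh).arc 2 = {z : ℂ | z.re = w ∧ z.im ∈ Icc (0 : ℝ) h} := by
  ext z
  simp only [brRect, MarkedDomain.arc_map, mem_image, mem_setOf_eq]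
  constructor
  · rintro ⟨u, hu, rfl⟩
    rw [mem_rectQuad_arc_two] at hu
    obtain ⟨hi, hr1, hr2⟩ := hu
    obtain ⟨e1, e2⟩ := brHomeo_re_im h u
    rw [e1, e2, hi]
    exact ⟨rfl, by linarith, by linarith⟩
  · rintro ⟨hre, h1, h2⟩
    refine ⟨⟨h - z.im, z.re⟩, ?_, brHomeo_mk h z⟩
    rw [mem_rectQuad_arc_two]
    exact ⟨hre, by change 0 ≤ h - z.im; linarith, by change h - z.im ≤ h; linarith⟩

end RectBoxExists

/-- **The corner-marked box `(0,A)×(0,1)` exists as a rectilinear conformal rectangle** with arc `0`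
its left side and arc `2` its right side (registered sub-goal `rc_exists_boxRect` of line
`two-cluster-rate-is-stationary-gap`): the Bollobás–Riordan rectangle `brRect A 1` of the tree.
[folklore] -/
theorem rc_exists_boxRect :
    ∀ A : ℕ, 1 ≤ A → ∃ R : Literature.Probability.RandomPlanarGeometry.ConformalRectangle,
      R.carrier = (Set.Ioo (0 : ℝ) A ×ℂ Set.Ioo (0 : ℝ) 1) ∧
      R.arc 0 = {z : ℂ | z.re = 0 ∧ z.im ∈ Set.Icc (0 : ℝ) 1} ∧
      R.arc 2 = {z : ℂ | z.re = A ∧ z.im ∈ Set.Icc (0 : ℝ) 1} ∧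
      (R.pt 0 = ((1 : ℝ) : ℂ) * Complex.I ∧ R.pt 1 = 0 ∧ R.pt 2 = ((A : ℝ) : ℂ) ∧
        R.pt 3 = ((A : ℝ) : ℂ) + ((1 : ℝ) : ℂ) * Complex.I) ∧
      (∃ S : Finset (ℂ × ℂ), (∀ p ∈ S, p.1.re = p.2.re ∨ p.1.im = p.2.im) ∧
        frontier R.carrier ⊆ ⋃ p ∈ S, segment ℝ p.1 p.2) := by
  intro A hA
  have hA' : (0 : ℝ) < A := by exact_mod_cast hA
  exact ⟨brRect A 1 hA' one_pos, brRect_carrier _ _ hA' one_pos,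
    RectBoxExists.brRect_arc_zero _ _ hA' one_pos, RectBoxExists.brRect_arc_two _ _ hA' one_pos,
    brRect_pt _ _ hA' one_pos, isRectilinear_brRect _ _ hA' one_pos⟩

end Summit.CriticalPhenomena.CardyFormulaZ2.Cruxes.StripClusterRates.TwoClusterRateIsStationaryGap

end
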